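import Summits.BirchSwinnertonDyer.BirchSwinnertonDyer.Theses.AdditiveBranchIMC
import HarnessLib

/-! BC3 birth skeleton for crux `AdditiveBranchIMC.ReadingFacts` (route AdditiveBranchIMC, rung K1):
v2 (A12-admitted shape, planner g12): named stubs (the ONLY sorried declarations) + the kernel-checked composition `ReadingFacts_of` concluding the crux BY NAME. -/

set_option autoImplicit false

set_option linter.dupNamespace false

namespace Summit.BirchSwinnertonDyer.BirchSwinnertonDyer.Cruxes.ReadingFacts.Birth

open scoped Classical

open WeierstrassCurve Literature.NumberTheory.EllipticCurves
  Literature.NumberTheory.EllipticCurves.ModularForms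
  Literature.NumberTheory.EllipticCurves.GreenbergVatsal2000
  Literature.NumberTheory.EllipticCurves.Rank1Residual
  Literature.NumberTheory.EllipticCurves.Rank1Residual.Typed
  Literature.NumberTheory.GaloisRepresentations
  IsDedekindDomain NumberField

open Summit.BirchSwinnertonDyer.Rank1Residual.Additive
open Summit.BirchSwinnertonDyer.BirchSwinnertonDyer.Theses.AdditiveBranchIMC

/-- stub (wuthrichSixteen): Wuthrich 2014 Thm 16 as typed (half the χ-eigen characteristic ideal divides the cyclotomic prime) — a reading at additive p; closes by formalisation or a D-audit «weaker than print». -/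
theorem stub_wuthrichSixteen :
    Wuthrich2014.thm16_halfEigenCharIdeal_dvd_cyclotomicPrime := by
  sorry

/-- stub (gvBranch): Greenberg–Vatsal 2000 Thm (3.12) on the ω^{(p−1)/2}-branch as typed (unit content + λ from the residual representation); odd-sign/non-optimal period step = Rem (3.9) + Vatsal 2005 Thm 1.11 at p ≥ 7 (lit 19:49Z). -/
theorem stub_gvBranch :
    thm312_branch_unitContent_and_lambda_eq_residual_goodOrd := by
  sorry

/-- stub (liftRamifiedEven): GV 2000 p. 28 / p. 30 residual lifting with a prescribed RAMIFIED even line (p ≥ 5 rows) as typed. -/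
theorem stub_liftRamifiedEven :
    residualEpsilon_surjOn_of_lineRamifiedEven := by
  sorry

/-- stub (liftEven): GV 2000 p. 28 / p. 30 residual lifting with a prescribed even line (p = 3 rows) as typed. -/
theorem stub_liftEven :
    residualEpsilon_surjOn_of_lineEven := by
  sorry

/-- stub (delbourgoPropFourUnit): Delbourgo 1998 Thm 3 + Prop 4 in the exact unit form at a potentially good ordinary p as typed (§2.2 Lemma (i) evaluation). -/
theorem stub_delbourgoPropFourUnit :
    Delbourgo1998.prop4_rankZero_constantCoeff_eq_unit_mul_of_potGoodOrd := by
  sorry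

/-- BC3 composition = THE SKELETON (A12 shape, v2): the crux BY NAME with NO hypotheses, from exactly the five
registered stubs (one per reading fact of the conjunction); kernel-checked, no sorry of its own. -/
theorem ReadingFacts_of :
    Summit.BirchSwinnertonDyer.BirchSwinnertonDyer.Theses.AdditiveBranchIMC.ReadingFacts :=
  ⟨stub_wuthrichSixteen, stub_gvBranch, stub_liftRamifiedEven, stub_liftEven, stub_delbourgoPropFourUnit⟩

end Summit.BirchSwinnertonDyer.BirchSwinnertonDyer.Cruxes.ReadingFacts.Birth
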